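import Mathlib
import Literature.NumberTheory.LFunctions.WeilMarkovQuadratic
import Literature.NumberTheory.LFunctions.WeilWindowSuzukiProofs
import Summits.RiemannHypothesis.RiemannHypothesis.Theorems.WeilGroundStateArchimedeanWindowSimpleEvenTrial3
import HarnessLib

/-!
# The parabolic bump `h_b(x) = (1 − x²/b²)⁺`: norm, increments and archimedean energy

Stub `stub_parabolaIncrementEnergy` (PAR1) for the line *parity–multiplicity–commutator* of the crux
`GroundStateSimpleEven` (Weil ground state).

The parabolic bump on the window `[-b, b]` is the rescaled tree bump of
`WeilGroundStateArchimedeanWindowSimpleEvenTrial1–3`: `h_b(x) = trialFun (x/(3b))`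
(`trialFun y = (1 − 9y²)⁺`), so the substitution `x = 3b·y` gives

* `‖h_b‖₂² = 3b · 16/45 = 16b/15`;
* `D_t(h_b) = 3b · D_{t/(3b)}(trialFun)` (`D_t = weilIncrement`), i.e.
  `D_t(h_b) = 8t²/(3b) − 4t³/(3b²) + t⁵/(15b⁴)` for `0 ≤ t ≤ 2b` and `D_t(h_b) = 32b/15 = 2‖h_b‖₂²`
  for `t ≥ 2b`;
* with the density bound `2t ρ(t) ≤ 1 + t/2`, `ρ(t) = e^{t/2}/(2 sinh t)` (i.e. `ρ(t) ≤ 1/(2t) + 1/4`;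
  from the tree's Padé bound `2tρ(t) ≤ e^{-t/2}(1 + t + t²/3)` and `e^{t/2} ≥ 1 + t/2 + t²/8`),
  `t ↦ ρ(t) D_t(h_b)` is integrable on `(0, ∞)` and
  `∫_{(0,2b]} ρ(t) D_t(h_b) dt ≤ ∫₀^{2b} (1 + t/2)(4t/(3b) − 2t²/(3b²) + t⁴/(30b⁴)) dt = b (248/225 + 28b/45)`.
-/

open Set MeasureTheory Filter
open scoped Real Topology
open Literature.NumberTheory.LFunctions

namespace Summit.RiemannHypothesis.RiemannHypothesis.Theorems.GroundStateSimpleEven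

open Summit.RiemannHypothesis.RiemannHypothesis.Theorems.WeilGroundState

set_option linter.dupNamespace false in
/-- The parabolic bump is the rescaled tree bump: `(1 − x²/b²)⁺ = trialFun (x/(3b))`. [folklore] -/
theorem par_bump_eq (b x : ℝ) :
    (((max (1 - (x / b) ^ 2) 0 : ℝ)) : ℂ) = trialFun (x / (3 * b)) := by
  have h : 9 * (x / (3 * b)) ^ 2 = (x / b) ^ 2 := by ring
  rw [trialFun_apply, h]

set_option linter.dupNamespace false in
/-- `‖h_b‖₂² = 16b/15` (substitute `x = 3b·y` in `‖trialFun‖₂² = 16/45`). [folklore] -/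
theorem par_integral_norm_sq {b : ℝ} (hb : 0 < b) :
    ∫ x : ℝ, ‖(((max (1 - (x / b) ^ 2) 0 : ℝ)) : ℂ)‖ ^ 2 = 16 * b / 15 := by
  simp_rw [par_bump_eq b]
  have h := Measure.integral_comp_div (fun y ↦ ‖trialFun y‖ ^ 2) (3 * b)
  rw [h, integral_norm_sq_trialFun, abs_of_pos (by positivity), smul_eq_mul]
  ring

set_option linter.dupNamespace false in
/-- `D_t(h_b) = 3b · D_{t/(3b)}(trialFun)` (substitute `x = 3b·y`). [folklore] -/
theorem par_weilIncrement_eq {b : ℝ} (hb : 0 < b) (t : ℝ) :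
    weilIncrement (fun x : ℝ ↦ (((max (1 - (x / b) ^ 2) 0 : ℝ)) : ℂ)) t =
      3 * b * weilIncrement trialFun (t / (3 * b)) := by
  unfold weilIncrement
  simp only [par_bump_eq b]
  simp only [add_div]
  have h := Measure.integral_comp_div (fun y ↦ ‖trialFun (y + t / (3 * b)) - trialFun y‖ ^ 2) (3 * b)
  rw [h, abs_of_pos (by positivity), smul_eq_mul]

set_option linter.dupNamespace false in
/-- `D_t(h_b) = 8t²/(3b) − 4t³/(3b²) + t⁵/(15b⁴)` for `0 ≤ t ≤ 2b`. [folklore] -/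
theorem par_weilIncrement_of_le {b t : ℝ} (hb : 0 < b) (ht0 : 0 ≤ t) (ht : t ≤ 2 * b) :
    weilIncrement (fun x : ℝ ↦ (((max (1 - (x / b) ^ 2) 0 : ℝ)) : ℂ)) t =
      8 * t ^ 2 / (3 * b) - 4 * t ^ 3 / (3 * b ^ 2) + t ^ 5 / (15 * b ^ 4) := by
  have hb3 : 0 < 3 * b := by positivity
  have hs0 : 0 ≤ t / (3 * b) := div_nonneg ht0 hb3.le
  have hs : t / (3 * b) ≤ 2 / 3 := by rw [div_le_iff₀ hb3]; linarith
  rw [par_weilIncrement_eq hb, weilIncrement_trialFun_of_le hs0 hs]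
  field_simp
  ring

set_option linter.dupNamespace false in
/-- `D_t(h_b) = 32b/15 = 2‖h_b‖₂²` for `t ≥ 2b` (disjoint supports). [folklore] -/
theorem par_weilIncrement_of_ge {b t : ℝ} (hb : 0 < b) (ht : 2 * b ≤ t) :
    weilIncrement (fun x : ℝ ↦ (((max (1 - (x / b) ^ 2) 0 : ℝ)) : ℂ)) t = 32 * b / 15 := by
  have hb3 : 0 < 3 * b := by positivity
  have hs : 2 / 3 ≤ t / (3 * b) := by rw [le_div_iff₀ hb3]; linarith
  rw [par_weilIncrement_eq hb, weilIncrement_trialFun_of_ge hs]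
  ring

set_option linter.dupNamespace false in
/-- The archimedean density against the increment weight: `2t ρ(t) ≤ 1 + t/2` for `t > 0`, i.e.
`ρ(t) ≤ 1/(2t) + 1/4` (`2tρ(t) ≤ e^{-t/2}(1 + t + t²/3)` and `1 + t + t²/3 ≤ e^{t/2}(1 + t/2)`
by `e^{t/2} ≥ 1 + t/2 + t²/8`). [folklore] -/
theorem par_two_mul_mul_weilArchDensity_le {t : ℝ} (ht : 0 < t) :
    2 * t * weilArchDensity t ≤ 1 + t / 2 := by
  have h1 := two_mul_mul_weilArchDensity_le ht
  have hq := Real.quadratic_le_exp_of_nonneg (by linarith : 0 ≤ t / 2)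
  have h2 : (1 + t / 2 + (t / 2) ^ 2 / 2) * (1 + t / 2) ≤ Real.exp (t / 2) * (1 + t / 2) :=
    mul_le_mul_of_nonneg_right hq (by linarith)
  have h3 : 1 + t + t ^ 2 / 3 ≤ Real.exp (t / 2) * (1 + t / 2) := by
    nlinarith [h2, sq_nonneg t, mul_nonneg (sq_nonneg t) ht.le]
  have h4 : Real.exp (-(t / 2)) * (1 + t + t ^ 2 / 3) ≤ 1 + t / 2 := by
    rw [Real.exp_neg, inv_mul_le_iff₀ (Real.exp_pos _)]
    exact h3
  exact h1.trans h4

set_option linter.dupNamespace false in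
/-- `∫₀^a (c₁x + c₂x² + c₃x³ + c₄x⁴ + c₅x⁵) dx` in closed form. [folklore] -/
theorem par_integral_poly5 (a c1 c2 c3 c4 c5 : ℝ) :
    ∫ x in (0 : ℝ)..a, (c1 * x + c2 * x ^ 2 + c3 * x ^ 3 + c4 * x ^ 4 + c5 * x ^ 5) =
      c1 * (a ^ 2 / 2) + c2 * (a ^ 3 / 3) + c3 * (a ^ 4 / 4) + c4 * (a ^ 5 / 5) +
        c5 * (a ^ 6 / 6) := by
  have i1 : IntervalIntegrable (fun x : ℝ ↦ c1 * x) volume 0 a :=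
    (continuous_const.mul continuous_id).intervalIntegrable _ _
  have i2 : IntervalIntegrable (fun x : ℝ ↦ c2 * x ^ 2) volume 0 a :=
    (continuous_const.mul (continuous_pow 2)).intervalIntegrable _ _
  have i3 : IntervalIntegrable (fun x : ℝ ↦ c3 * x ^ 3) volume 0 a :=
    (continuous_const.mul (continuous_pow 3)).intervalIntegrable _ _
  have i4 : IntervalIntegrable (fun x : ℝ ↦ c4 * x ^ 4) volume 0 a :=
    (continuous_const.mul (continuous_pow 4)).intervalIntegrable _ _
  have i5 : IntervalIntegrable (fun x : ℝ ↦ c5 * x ^ 5) volume 0 a :=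
    (continuous_const.mul (continuous_pow 5)).intervalIntegrable _ _
  rw [intervalIntegral.integral_add (((i1.add i2).add i3).add i4) i5,
    intervalIntegral.integral_add ((i1.add i2).add i3) i4,
    intervalIntegral.integral_add (i1.add i2) i3, intervalIntegral.integral_add i1 i2,
    intervalIntegral.integral_const_mul, intervalIntegral.integral_const_mul,
    intervalIntegral.integral_const_mul, intervalIntegral.integral_const_mul,
    intervalIntegral.integral_const_mul, integral_pow, integral_pow, integral_pow, integral_pow,
    show (∫ x in (0 : ℝ)..a, x) = (a ^ 2 - 0 ^ 2) / 2 from integral_id]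
  push_cast
  ring

set_option linter.dupNamespace false in
/-- The polynomial majorant of `ρ(t) D_t(h_b)` on `(0, 2b]`, expanded in powers of `t`. [folklore] -/
theorem par_majorant_expand (b t : ℝ) :
    (1 + t / 2) * (4 * t / (3 * b) - 2 * t ^ 2 / (3 * b ^ 2) + t ^ 4 / (30 * b ^ 4)) =
      4 / (3 * b) * t + (2 / (3 * b) - 2 / (3 * b ^ 2)) * t ^ 2 + (-(1 / (3 * b ^ 2))) * t ^ 3 +
        1 / (30 * b ^ 4) * t ^ 4 + 1 / (60 * b ^ 4) * t ^ 5 := by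
  ring

set_option linter.dupNamespace false in
/-- **The bulk of the energy of the parabolic bump.** `t ↦ ρ(t) D_t(h_b)` is integrable on
`(0, 2b]` and `∫_{(0,2b]} ρ(t) D_t(h_b) dt ≤ b (248/225 + 28b/45)`: on `(0, 2b]`,
`ρ D_t(h_b) = (2tρ) · (4t/(3b) − 2t²/(3b²) + t⁴/(30b⁴)) ≤ (1 + t/2)(4t/(3b) − 2t²/(3b²) + t⁴/(30b⁴))`,
a polynomial whose integral over `[0, 2b]` is `b (248/225 + 28b/45)`. [folklore] -/
theorem par_setIntegral_Ioc_le {b : ℝ} (hb : 0 < b) :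
    IntegrableOn (fun t : ℝ ↦ weilArchDensity t *
        weilIncrement (fun x : ℝ ↦ (((max (1 - (x / b) ^ 2) 0 : ℝ)) : ℂ)) t) (Ioc 0 (2 * b)) ∧
      ∫ t in Ioc 0 (2 * b), weilArchDensity t *
          weilIncrement (fun x : ℝ ↦ (((max (1 - (x / b) ^ 2) 0 : ℝ)) : ℂ)) t ≤
        b * (248 / 225 + 28 / 45 * b) := by
  set Pm : ℝ → ℝ := fun t ↦
    (1 + t / 2) * (4 * t / (3 * b) - 2 * t ^ 2 / (3 * b ^ 2) + t ^ 4 / (30 * b ^ 4)) with hPm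
  set f₁ : ℝ → ℝ := fun t ↦ weilArchDensity t *
    (8 * t ^ 2 / (3 * b) - 4 * t ^ 3 / (3 * b ^ 2) + t ^ 5 / (15 * b ^ 4)) with hf₁
  have hs : MeasurableSet (Ioc (0 : ℝ) (2 * b)) := measurableSet_Ioc
  -- pointwise bounds on the set
  have hbd : ∀ t ∈ Ioc (0 : ℝ) (2 * b), 0 ≤ f₁ t ∧ f₁ t ≤ Pm t := by
    rintro t ⟨ht0, ht⟩
    have hK : 0 ≤ 4 * t / (3 * b) - 2 * t ^ 2 / (3 * b ^ 2) + t ^ 4 / (30 * b ^ 4) := by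
      have hD : 0 ≤ 8 * t ^ 2 / (3 * b) - 4 * t ^ 3 / (3 * b ^ 2) + t ^ 5 / (15 * b ^ 4) := by
        rw [← par_weilIncrement_of_le hb ht0.le ht]
        exact weilIncrement_nonneg _ _
      have e : 8 * t ^ 2 / (3 * b) - 4 * t ^ 3 / (3 * b ^ 2) + t ^ 5 / (15 * b ^ 4) =
          2 * t * (4 * t / (3 * b) - 2 * t ^ 2 / (3 * b ^ 2) + t ^ 4 / (30 * b ^ 4)) := by ring
      rw [e] at hD
      exact (mul_nonneg_iff_of_pos_left (by positivity)).1 hD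
    have e1 : f₁ t = (2 * t * weilArchDensity t) *
        (4 * t / (3 * b) - 2 * t ^ 2 / (3 * b ^ 2) + t ^ 4 / (30 * b ^ 4)) := by
      rw [hf₁]; ring
    have hρ := weilArchDensity_pos ht0
    refine ⟨?_, ?_⟩
    · rw [e1]
      exact mul_nonneg (mul_nonneg (by positivity) hρ.le) hK
    · rw [e1, hPm]
      exact mul_le_mul_of_nonneg_right (par_two_mul_mul_weilArchDensity_le ht0) hK
  -- integrability
  have hPmc : Continuous Pm := by rw [hPm]; fun_prop
  have hPmi : IntegrableOn Pm (Ioc 0 (2 * b)) := (hPmc.integrableOn_Icc).mono_set Ioc_subset_Icc_self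
  have hf₁m : AEStronglyMeasurable f₁ (volume.restrict (Ioc 0 (2 * b))) := by
    rw [hf₁]
    exact (measurable_weilArchDensity'.mul (by fun_prop)).aestronglyMeasurable
  have hf₁i : IntegrableOn f₁ (Ioc 0 (2 * b)) := by
    refine Integrable.mono' hPmi hf₁m ((ae_restrict_iff' hs).2 (Eventually.of_forall fun t ht ↦ ?_))
    obtain ⟨h0, h1⟩ := hbd t ht
    rw [Real.norm_of_nonneg h0]
    exact h1
  have heq : EqOn (fun t : ℝ ↦ weilArchDensity t *
      weilIncrement (fun x : ℝ ↦ (((max (1 - (x / b) ^ 2) 0 : ℝ)) : ℂ)) t) f₁ (Ioc 0 (2 * b)) := by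
    intro t ht
    simp only [hf₁]
    rw [par_weilIncrement_of_le hb ht.1.le ht.2]
  have hfi : IntegrableOn (fun t : ℝ ↦ weilArchDensity t *
      weilIncrement (fun x : ℝ ↦ (((max (1 - (x / b) ^ 2) 0 : ℝ)) : ℂ)) t) (Ioc 0 (2 * b)) :=
    hf₁i.congr_fun heq.symm hs
  refine ⟨hfi, ?_⟩
  rw [setIntegral_congr_fun hs heq]
  calc ∫ t in Ioc (0 : ℝ) (2 * b), f₁ t ≤ ∫ t in Ioc (0 : ℝ) (2 * b), Pm t :=
        setIntegral_mono_on hf₁i hPmi hs fun t ht ↦ (hbd t ht).2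
    _ = ∫ t in (0 : ℝ)..(2 * b), Pm t := (intervalIntegral.integral_of_le (by linarith)).symm
    _ = ∫ t in (0 : ℝ)..(2 * b), (4 / (3 * b) * t + (2 / (3 * b) - 2 / (3 * b ^ 2)) * t ^ 2 +
          (-(1 / (3 * b ^ 2))) * t ^ 3 + 1 / (30 * b ^ 4) * t ^ 4 + 1 / (60 * b ^ 4) * t ^ 5) :=
        intervalIntegral.integral_congr fun t _ ↦ par_majorant_expand b t
    _ = b * (248 / 225 + 28 / 45 * b) := by
        rw [par_integral_poly5]
        field_simp
        ring

end Summit.RiemannHypothesis.RiemannHypothesis.Theorems.GroundStateSimpleEven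

namespace Summit.RiemannHypothesis.RiemannHypothesis.Theorems

set_option linter.dupNamespace false in
/-- **The parabolic bump `h_b(x) = (1 − x²/b²)⁺` on the window `[-b, b]` (`b > 0`).**
(1) `‖h_b‖₂² = 16b/15`; (2) `D_t(h_b) = 32b/15 = 2‖h_b‖₂²` for `t ≥ 2b` (disjoint supports);
(3) `t ↦ ρ(t) D_t(h_b)` is integrable on `(0, ∞)` (`ρ(t) = e^{t/2}/(2 sinh t)`, `D_t = weilIncrement`);
(4) `∫_{(0,2b]} ρ(t) D_t(h_b) dt ≤ b (248/225 + 28b/45)` (by `ρ(t) ≤ 1/(2t) + 1/4` and the closed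
form `D_t(h_b) = 8t²/(3b) − 4t³/(3b²) + t⁵/(15b⁴)` on `[0, 2b]`). All by rescaling the tree bump
`trialFun = (1 − 9x²)⁺`: `h_b(x) = trialFun (x/(3b))`. [folklore] -/
theorem stub_parabolaIncrementEnergy :
    ∀ b : ℝ, 0 < b →
      (∫ x : ℝ, ‖(((max (1 - (x / b) ^ 2) 0 : ℝ)) : ℂ)‖ ^ 2 = 16 * b / 15) ∧
      (∀ t : ℝ, 2 * b ≤ t →
        weilIncrement (fun x : ℝ ↦ (((max (1 - (x / b) ^ 2) 0 : ℝ)) : ℂ)) t = 32 * b / 15) ∧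
      IntegrableOn (fun t : ℝ ↦ weilArchDensity t *
        weilIncrement (fun x : ℝ ↦ (((max (1 - (x / b) ^ 2) 0 : ℝ)) : ℂ)) t) (Ioi 0) ∧
      ∫ t in Ioc 0 (2 * b), weilArchDensity t *
          weilIncrement (fun x : ℝ ↦ (((max (1 - (x / b) ^ 2) 0 : ℝ)) : ℂ)) t ≤
        b * (248 / 225 + 28 / 45 * b) := by
  intro b hb
  obtain ⟨hi1, hb1⟩ := GroundStateSimpleEven.par_setIntegral_Ioc_le hb
  refine ⟨GroundStateSimpleEven.par_integral_norm_sq hb,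
    fun t ht ↦ GroundStateSimpleEven.par_weilIncrement_of_ge hb ht, ?_, hb1⟩
  have h2b : 0 < 2 * b := by positivity
  have heq : EqOn (fun t : ℝ ↦ weilArchDensity t *
        weilIncrement (fun x : ℝ ↦ (((max (1 - (x / b) ^ 2) 0 : ℝ)) : ℂ)) t)
      (fun t : ℝ ↦ weilArchDensity t * (32 * b / 15)) (Ioi (2 * b)) := by
    intro t ht
    have ht' : 2 * b < t := ht
    simp only
    rw [GroundStateSimpleEven.par_weilIncrement_of_ge hb ht'.le]
  have hi2c : IntegrableOn (fun t : ℝ ↦ weilArchDensity t * (32 * b / 15)) (Ioi (2 * b)) :=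
    (integrableOn_weilArchDensity_Ioi h2b).mul_const _
  have hi2 : IntegrableOn (fun t : ℝ ↦ weilArchDensity t *
        weilIncrement (fun x : ℝ ↦ (((max (1 - (x / b) ^ 2) 0 : ℝ)) : ℂ)) t) (Ioi (2 * b)) :=
    hi2c.congr_fun heq.symm measurableSet_Ioi
  rw [← Ioc_union_Ioi_eq_Ioi h2b.le]
  exact hi1.union hi2

end Summit.RiemannHypothesis.RiemannHypothesis.Theorems
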